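import Summits.ValiantsHypothesis.ValiantsHypothesis.Theorems.FeketeSOSFeketeSOSHardPaleyRIPBurgessRange

/-!
# Route FeketeSOS — crux `FeketeSOSHard` (stmt-ValiantsHypothesis-3996), line `paley-rip` (v3),
# stub `stub_paleyFlatRIP`: bilinear Hankel–Fourier bound — two progressions, and the Paley GRAPH
# (difference) kernel on two short intervals

`…PaleyRIPHankelFourier.lean` bounds the quadratic form `Σ_{a,b∈S} c(φa+φb) w_a w_b` of a Hankel kernel by
the sup of the symbol's DFT.  The same three-line Fourier argument bounds the BILINEAR form with two
different index maps — `|Σ_{a∈S₁,b∈S₂} c(φa+ψb) u_a v_b| ≤ ‖𝓕c‖_∞ ‖u‖₂‖v‖₂` (`norm_hankelBilin_le_of_dft_bound`)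
— which covers two cases the quadratic form does not:

* rows and columns in two DIFFERENT progressions with the same step, `S₁ ⊆ {x₁ + jd}`, `S₂ ⊆ {x₂ + jd}`
  (`norm_paleyBilin_le_of_progressions`: kernel `χ_p(a+b) = χ_p(x₁+x₂+(j+j')d)`);
* the Paley GRAPH kernel `χ_p(a − b)` on two short intervals `[x₁,x₁+N) × [x₂,x₂+N)`: reversing the
  column index (`ψ b = x₂+N−1−b`) makes `a − b = (x₁−x₂−N+1) + φa + ψb` a Hankel pattern
  (`norm_paleyDiffBilin_le_of_intervals`).

Conditionally on the published mixed Burgess bound (`Literature.NumberTheory.GaussSums.BurgessBoundLinearPhase`,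
Heath-Brown–Pierce 2015 Thm 1.4) this gives, for `κ + (2/3)δ₁ < 1/24` and all large `p`
(`mixedBound_of_burgessBoundLinearPhase` packages the exponent bookkeeping once):

* `paleyGraph_subpairs_intervals_of_burgessBoundLinearPhase` — **the Paley graph conjecture holds for
  vertex sets inside short intervals**: `|Σ_{a∈A,b∈B} χ_p(a−b)| ≤ p^{1/2−κ}√(#A#B)` for ALL
  `A ⊆ [x₁,x₁+N)`, `B ⊆ [x₂,x₂+N)`, `N ≤ p^{1/2+δ₁}` (the Chor–Goldreich / Chung property `𝒫(α,β)` below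
  `α = 1/2`, restricted to sub-pairs of short intervals);
* `paleySum_subpairs_two_intervals_of_burgessBoundLinearPhase` — the same for `χ_p(a+b)` with `A`, `B` in
  two (possibly different) short intervals.

Honest framing (rung currency): Theorems-side helper `--supports` stmt-3996; CONDITIONAL on the named fact
where stated; the engine for general supports (= the Paley graph conjecture below `1/2`),
`stub_tameOperator` and the crux stay OPEN; `VP ≠ VNP` is untouched.
-/

set_option linter.dupNamespace false

namespace Summit.ValiantsHypothesis.ValiantsHypothesis.Theorems.FeketeSOSHardPaleyRIP

open Finset Complex
open scoped BigOperators ZMod Real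

noncomputable section

/-! ## The bilinear Hankel–Fourier bound -/

section Bilinear

variable {M : ℕ} [NeZero M]

/-- `Σ_k 𝓕c(k)·(Σ_{a∈S₁} u_a e_M(φ(a)k))·(Σ_{b∈S₂} v_b e_M(ψ(b)k)) = M·Σ_{a,b} c(φa+ψb) u_a v_b`. [folklore] -/
theorem dft_mul_trigSum_mul_trigSum_sum (c : ZMod M → ℂ) {α β : Type*} (S₁ : Finset α) (S₂ : Finset β)
    (φ : α → ZMod M) (ψ : β → ZMod M) (u : α → ℂ) (v : β → ℂ) :
    ∑ k : ZMod M, 𝓕 c k * (∑ a ∈ S₁, u a * (ZMod.stdAddChar (φ a * k) : ℂ)) *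
        (∑ b ∈ S₂, v b * (ZMod.stdAddChar (ψ b * k) : ℂ)) =
      (M : ℂ) * ∑ a ∈ S₁, ∑ b ∈ S₂, c (φ a + ψ b) * u a * v b := by
  have hexp : ∀ k : ZMod M, 𝓕 c k * (∑ a ∈ S₁, u a * (ZMod.stdAddChar (φ a * k) : ℂ)) *
      (∑ b ∈ S₂, v b * (ZMod.stdAddChar (ψ b * k) : ℂ)) =
      ∑ z : ZMod M, ∑ a ∈ S₁, ∑ b ∈ S₂,
        c z * u a * v b * (ZMod.stdAddChar ((φ a + ψ b - z) * k) : ℂ) := by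
    intro k
    rw [ZMod.dft_apply, Finset.sum_mul, Finset.sum_mul]
    refine Finset.sum_congr rfl fun z _ => ?_
    rw [smul_eq_mul, mul_assoc, Finset.sum_mul_sum, Finset.mul_sum]
    refine Finset.sum_congr rfl fun a _ => ?_
    rw [Finset.mul_sum]
    refine Finset.sum_congr rfl fun b _ => ?_
    have hchar : (ZMod.stdAddChar (-(z * k)) : ℂ) * ZMod.stdAddChar (φ a * k) *
        ZMod.stdAddChar (ψ b * k) = ZMod.stdAddChar ((φ a + ψ b - z) * k) := by
      rw [← AddChar.map_add_eq_mul, ← AddChar.map_add_eq_mul]; congr 1; ring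
    calc ZMod.stdAddChar (-(z * k)) * c z * (u a * ZMod.stdAddChar (φ a * k) *
          (v b * ZMod.stdAddChar (ψ b * k)))
        = c z * u a * v b * ((ZMod.stdAddChar (-(z * k)) : ℂ) * ZMod.stdAddChar (φ a * k) *
            ZMod.stdAddChar (ψ b * k)) := by ring
      _ = _ := by rw [hchar]
  simp_rw [hexp]
  rw [Finset.sum_comm]
  have hin : ∀ z : ZMod M, (∑ k : ZMod M, ∑ a ∈ S₁, ∑ b ∈ S₂,
      c z * u a * v b * (ZMod.stdAddChar ((φ a + ψ b - z) * k) : ℂ)) =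
      ∑ a ∈ S₁, ∑ b ∈ S₂, c z * u a * v b * (if φ a + ψ b - z = 0 then (M : ℂ) else 0) := by
    intro z
    rw [Finset.sum_comm]
    refine Finset.sum_congr rfl fun a _ => ?_
    rw [Finset.sum_comm]
    refine Finset.sum_congr rfl fun b _ => ?_
    rw [← Finset.mul_sum, Literature.Analysis.Fourier.sum_stdAddChar_mul]
  simp_rw [hin]
  rw [Finset.sum_comm, Finset.mul_sum]
  refine Finset.sum_congr rfl fun a _ => ?_
  rw [Finset.sum_comm, Finset.mul_sum]
  refine Finset.sum_congr rfl fun b _ => ?_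
  rw [Finset.sum_eq_single (φ a + ψ b)]
  · rw [if_pos (sub_self _)]; ring
  · intro z _ hz
    rw [if_neg (fun h => hz (sub_eq_zero.1 h).symm), mul_zero]
  · intro h; exact absurd (Finset.mem_univ _) h

/-- **Bilinear Hankel–Fourier bound.**  If `|𝓕c(k)| ≤ B` for all `k` and `φ`, `ψ` are injective on `S₁`, `S₂`,
then `|Σ_{a∈S₁,b∈S₂} c(φ(a)+ψ(b)) u_a v_b| ≤ B·(Σ|u_a|²)^{1/2}(Σ|v_b|²)^{1/2}`. [folklore] -/
theorem norm_hankelBilin_le_of_dft_bound (c : ZMod M → ℂ) (B : ℝ) (hB : ∀ k, ‖𝓕 c k‖ ≤ B)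
    {α β : Type*} (S₁ : Finset α) (φ : α → ZMod M) (hφ : Set.InjOn φ S₁)
    (S₂ : Finset β) (ψ : β → ZMod M) (hψ : Set.InjOn ψ S₂) (u : α → ℂ) (v : β → ℂ) :
    ‖∑ a ∈ S₁, ∑ b ∈ S₂, c (φ a + ψ b) * u a * v b‖ ≤
      B * Real.sqrt (∑ a ∈ S₁, ‖u a‖ ^ 2) * Real.sqrt (∑ b ∈ S₂, ‖v b‖ ^ 2) := by
  have hM : (0 : ℝ) < (M : ℝ) := by exact_mod_cast Nat.pos_of_ne_zero (NeZero.ne M)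
  have hB0 : 0 ≤ B := (norm_nonneg _).trans (hB 0)
  set U : ZMod M → ℂ := fun k => ∑ a ∈ S₁, u a * (ZMod.stdAddChar (φ a * k) : ℂ) with hU
  set V : ZMod M → ℂ := fun k => ∑ b ∈ S₂, v b * (ZMod.stdAddChar (ψ b * k) : ℂ) with hV
  have key := dft_mul_trigSum_mul_trigSum_sum c S₁ S₂ φ ψ u v
  have hPU : ∑ k : ZMod M, ‖U k‖ ^ 2 = (M : ℝ) * ∑ a ∈ S₁, ‖u a‖ ^ 2 := sum_norm_sq_trigSum S₁ φ hφ u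
  have hPV : ∑ k : ZMod M, ‖V k‖ ^ 2 = (M : ℝ) * ∑ b ∈ S₂, ‖v b‖ ^ 2 := sum_norm_sq_trigSum S₂ ψ hψ v
  have h1 : (M : ℝ) * ‖∑ a ∈ S₁, ∑ b ∈ S₂, c (φ a + ψ b) * u a * v b‖ =
      ‖∑ k : ZMod M, 𝓕 c k * U k * V k‖ := by
    rw [hU, hV, key, norm_mul, Complex.norm_natCast]
  have h2 : ‖∑ k : ZMod M, 𝓕 c k * U k * V k‖ ≤ B * ∑ k : ZMod M, ‖U k‖ * ‖V k‖ := by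
    rw [Finset.mul_sum]
    refine (norm_sum_le _ _).trans (Finset.sum_le_sum fun k _ => ?_)
    rw [norm_mul, norm_mul, mul_assoc]
    exact mul_le_mul_of_nonneg_right (hB k) (mul_nonneg (norm_nonneg _) (norm_nonneg _))
  -- Cauchy–Schwarz over `k`
  have h3 : (∑ k : ZMod M, ‖U k‖ * ‖V k‖) ≤
      Real.sqrt (∑ k : ZMod M, ‖U k‖ ^ 2) * Real.sqrt (∑ k : ZMod M, ‖V k‖ ^ 2) := by
    have hcs := Finset.sum_mul_sq_le_sq_mul_sq (Finset.univ : Finset (ZMod M))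
      (fun k => ‖U k‖) (fun k => ‖V k‖)
    have h0 : 0 ≤ ∑ k : ZMod M, ‖U k‖ * ‖V k‖ :=
      Finset.sum_nonneg fun k _ => mul_nonneg (norm_nonneg _) (norm_nonneg _)
    rw [← Real.sqrt_mul (Finset.sum_nonneg fun k _ => sq_nonneg _)]
    exact (Real.le_sqrt h0 (mul_nonneg (Finset.sum_nonneg fun k _ => sq_nonneg _)
      (Finset.sum_nonneg fun k _ => sq_nonneg _))).2 hcs
  have h4 : Real.sqrt (∑ k : ZMod M, ‖U k‖ ^ 2) * Real.sqrt (∑ k : ZMod M, ‖V k‖ ^ 2) =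
      (M : ℝ) * (Real.sqrt (∑ a ∈ S₁, ‖u a‖ ^ 2) * Real.sqrt (∑ b ∈ S₂, ‖v b‖ ^ 2)) := by
    rw [hPU, hPV, Real.sqrt_mul hM.le, Real.sqrt_mul hM.le]
    have : Real.sqrt (M : ℝ) * Real.sqrt (M : ℝ) = (M : ℝ) := Real.mul_self_sqrt hM.le
    calc Real.sqrt (M : ℝ) * Real.sqrt (∑ a ∈ S₁, ‖u a‖ ^ 2) *
          (Real.sqrt (M : ℝ) * Real.sqrt (∑ b ∈ S₂, ‖v b‖ ^ 2))
        = (Real.sqrt (M : ℝ) * Real.sqrt (M : ℝ)) *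
            (Real.sqrt (∑ a ∈ S₁, ‖u a‖ ^ 2) * Real.sqrt (∑ b ∈ S₂, ‖v b‖ ^ 2)) := by ring
      _ = _ := by rw [this]
  have h5 : (M : ℝ) * ‖∑ a ∈ S₁, ∑ b ∈ S₂, c (φ a + ψ b) * u a * v b‖ ≤
      (M : ℝ) * (B * Real.sqrt (∑ a ∈ S₁, ‖u a‖ ^ 2) * Real.sqrt (∑ b ∈ S₂, ‖v b‖ ^ 2)) := by
    rw [h1]
    calc _ ≤ B * ∑ k : ZMod M, ‖U k‖ * ‖V k‖ := h2
      _ ≤ B * (Real.sqrt (∑ k : ZMod M, ‖U k‖ ^ 2) * Real.sqrt (∑ k : ZMod M, ‖V k‖ ^ 2)) :=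
          mul_le_mul_of_nonneg_left h3 hB0
      _ = _ := by rw [h4]; ring
  exact le_of_mul_le_mul_left h5 hM

end Bilinear

/-! ## The Paley sum / difference kernels on two short intervals -/

section Intervals

variable (p : ℕ) [Fact p.Prime]

/-- **Two intervals, sum kernel.**  For `S₁ ⊆ [x₁, x₁+N)`, `S₂ ⊆ [x₂, x₂+N)` and `M ≥ 2N−1`: if `c : ℤ/M → ℂ`
agrees with `s ↦ χ_p(x₁+x₂+s)` on `s ≤ 2N−2` and `|𝓕c| ≤ B`, then
`|Σ_{a∈S₁,b∈S₂} χ_p(a+b) u_a v_b| ≤ B‖u‖₂‖v‖₂`. [folklore] -/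
theorem norm_paleySumBilin_le_of_intervals (S₁ S₂ : Finset ℕ) (x₁ x₂ N : ℕ)
    (hI₁ : ∀ a ∈ S₁, x₁ ≤ a ∧ a < x₁ + N) (hI₂ : ∀ b ∈ S₂, x₂ ≤ b ∧ b < x₂ + N)
    (M : ℕ) [NeZero M] (hM : 2 * N ≤ M + 1) (c : ZMod M → ℂ)
    (hc : ∀ s : ℕ, s + 2 ≤ 2 * N → c (s : ZMod M) = ((legendreSym p ((x₁ : ℤ) + x₂ + s) : ℤ) : ℂ))
    (B : ℝ) (hB : ∀ k, ‖𝓕 c k‖ ≤ B) (u v : ℕ → ℂ) :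
    ‖∑ a ∈ S₁, ∑ b ∈ S₂, ((legendreSym p ((a : ℤ) + b) : ℤ) : ℂ) * u a * v b‖ ≤
      B * Real.sqrt (∑ a ∈ S₁, ‖u a‖ ^ 2) * Real.sqrt (∑ b ∈ S₂, ‖v b‖ ^ 2) := by
  have hMpos : 0 < M := Nat.pos_of_ne_zero (NeZero.ne M)
  let φ : ℕ → ZMod M := fun a => ((a - x₁ : ℕ) : ZMod M)
  let ψ : ℕ → ZMod M := fun b => ((b - x₂ : ℕ) : ZMod M)
  have hφ : Set.InjOn φ S₁ := by
    intro a ha a' ha' h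
    have h1 := (ZMod.natCast_eq_natCast_iff' (a - x₁) (a' - x₁) M).1 h
    have := hI₁ a ha; have := hI₁ a' ha'
    rw [Nat.mod_eq_of_lt (by omega), Nat.mod_eq_of_lt (by omega)] at h1
    omega
  have hψ : Set.InjOn ψ S₂ := by
    intro b hb b' hb' h
    have h1 := (ZMod.natCast_eq_natCast_iff' (b - x₂) (b' - x₂) M).1 h
    have := hI₂ b hb; have := hI₂ b' hb'
    rw [Nat.mod_eq_of_lt (by omega), Nat.mod_eq_of_lt (by omega)] at h1
    omega
  have hker : ∀ a ∈ S₁, ∀ b ∈ S₂,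
      ((legendreSym p ((a : ℤ) + b) : ℤ) : ℂ) = c (φ a + ψ b) := by
    intro a ha b hb
    have ha' := hI₁ a ha; have hb' := hI₂ b hb
    have hsum : φ a + ψ b = (((a - x₁) + (b - x₂) : ℕ) : ZMod M) := by simp only [φ, ψ]; push_cast; ring
    rw [hsum, hc _ (by omega)]
    have hab : (a : ℤ) + b = (x₁ : ℤ) + x₂ + ((a - x₁ + (b - x₂) : ℕ) : ℤ) := by
      push_cast [Nat.cast_sub ha'.1, Nat.cast_sub hb'.1]
      ring
    rw [hab]
  calc ‖∑ a ∈ S₁, ∑ b ∈ S₂, ((legendreSym p ((a : ℤ) + b) : ℤ) : ℂ) * u a * v b‖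
      = ‖∑ a ∈ S₁, ∑ b ∈ S₂, c (φ a + ψ b) * u a * v b‖ := by
        congr 1
        exact Finset.sum_congr rfl fun a ha => Finset.sum_congr rfl fun b hb => by rw [hker a ha b hb]
    _ ≤ _ := norm_hankelBilin_le_of_dft_bound c B hB S₁ φ hφ S₂ ψ hψ u v

/-- **Two intervals, DIFFERENCE kernel (Paley graph).**  For `S₁ ⊆ [x₁, x₁+N)`, `S₂ ⊆ [x₂, x₂+N)` and
`M ≥ 2N−1`: reversing the column index makes `χ_p(a − b)` a Hankel pattern with symbol
`s ↦ χ_p(x₁ − x₂ − N + 1 + s)`; if `c` agrees with it on `s ≤ 2N−2` and `|𝓕c| ≤ B`, then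
`|Σ_{a∈S₁,b∈S₂} χ_p(a−b) u_a v_b| ≤ B‖u‖₂‖v‖₂`. [folklore] -/
theorem norm_paleyDiffBilin_le_of_intervals (S₁ S₂ : Finset ℕ) (x₁ x₂ N : ℕ)
    (hI₁ : ∀ a ∈ S₁, x₁ ≤ a ∧ a < x₁ + N) (hI₂ : ∀ b ∈ S₂, x₂ ≤ b ∧ b < x₂ + N)
    (M : ℕ) [NeZero M] (hM : 2 * N ≤ M + 1) (c : ZMod M → ℂ)
    (hc : ∀ s : ℕ, s + 2 ≤ 2 * N →
      c (s : ZMod M) = ((legendreSym p ((x₁ : ℤ) - x₂ - N + 1 + s) : ℤ) : ℂ))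
    (B : ℝ) (hB : ∀ k, ‖𝓕 c k‖ ≤ B) (u v : ℕ → ℂ) :
    ‖∑ a ∈ S₁, ∑ b ∈ S₂, ((legendreSym p ((a : ℤ) - b) : ℤ) : ℂ) * u a * v b‖ ≤
      B * Real.sqrt (∑ a ∈ S₁, ‖u a‖ ^ 2) * Real.sqrt (∑ b ∈ S₂, ‖v b‖ ^ 2) := by
  have hMpos : 0 < M := Nat.pos_of_ne_zero (NeZero.ne M)
  let φ : ℕ → ZMod M := fun a => ((a - x₁ : ℕ) : ZMod M)
  let ψ : ℕ → ZMod M := fun b => ((x₂ + N - 1 - b : ℕ) : ZMod M)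
  have hφ : Set.InjOn φ S₁ := by
    intro a ha a' ha' h
    have h1 := (ZMod.natCast_eq_natCast_iff' (a - x₁) (a' - x₁) M).1 h
    have := hI₁ a ha; have := hI₁ a' ha'
    rw [Nat.mod_eq_of_lt (by omega), Nat.mod_eq_of_lt (by omega)] at h1
    omega
  have hψ : Set.InjOn ψ S₂ := by
    intro b hb b' hb' h
    have h1 := (ZMod.natCast_eq_natCast_iff' (x₂ + N - 1 - b) (x₂ + N - 1 - b') M).1 h
    have := hI₂ b hb; have := hI₂ b' hb'
    rw [Nat.mod_eq_of_lt (by omega), Nat.mod_eq_of_lt (by omega)] at h1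
    omega
  have hker : ∀ a ∈ S₁, ∀ b ∈ S₂,
      ((legendreSym p ((a : ℤ) - b) : ℤ) : ℂ) = c (φ a + ψ b) := by
    intro a ha b hb
    have ha' := hI₁ a ha; have hb' := hI₂ b hb
    have hsum : φ a + ψ b = (((a - x₁) + (x₂ + N - 1 - b) : ℕ) : ZMod M) := by
      simp only [φ, ψ]; push_cast; ring
    rw [hsum, hc _ (by omega)]
    congr 3
    have h1 : ((a - x₁ : ℕ) : ℤ) = (a : ℤ) - x₁ := by push_cast [Nat.cast_sub ha'.1]; ring
    have h2 : ((x₂ + N - 1 - b : ℕ) : ℤ) = (x₂ : ℤ) + N - 1 - b := by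
      rw [Nat.cast_sub (by omega), Nat.cast_sub (by omega)]; push_cast; ring
    push_cast
    rw [h1, h2]; ring
  calc ‖∑ a ∈ S₁, ∑ b ∈ S₂, ((legendreSym p ((a : ℤ) - b) : ℤ) : ℂ) * u a * v b‖
      = ‖∑ a ∈ S₁, ∑ b ∈ S₂, c (φ a + ψ b) * u a * v b‖ := by
        congr 1
        exact Finset.sum_congr rfl fun a ha => Finset.sum_congr rfl fun b hb => by rw [hker a ha b hb]
    _ ≤ _ := norm_hankelBilin_le_of_dft_bound c B hB S₁ φ hφ S₂ ψ hψ u v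

/-- The DFT of the truncated kernel `s ↦ χ_p(c₀ + s)` (`s < 2N−1`) on `ℤ/M` is the twisted short character sum
`Σ_{s<2N−1} χ_p(c₀+s) e(−sk/M)`. [folklore] -/
theorem dft_truncatedKernel (c₀ : ℤ) (N M : ℕ) [NeZero M] (hM : 2 * N ≤ M + 1) (k : ZMod M) :
    𝓕 (fun z : ZMod M => if z.val + 2 ≤ 2 * N then ((legendreSym p (c₀ + (z.val : ℤ)) : ℤ) : ℂ) else 0) k =
      ∑ s ∈ Finset.range (2 * N - 1), ((legendreSym p (c₀ + (s : ℤ)) : ℤ) : ℂ) *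
        (ZMod.stdAddChar (-((s : ZMod M) * k)) : ℂ) := by
  rw [ZMod.dft_apply, sum_zmod_eq_sum_range]
  symm
  rw [← Finset.sum_subset (Finset.range_subset_range.2 (show 2 * N - 1 ≤ M by omega))
    (f := fun s : ℕ => ZMod.stdAddChar (-((s : ZMod M) * k)) •
      (fun z : ZMod M => if z.val + 2 ≤ 2 * N then ((legendreSym p (c₀ + (z.val : ℤ)) : ℤ) : ℂ) else 0)
        (s : ZMod M))]
  · refine Finset.sum_congr rfl fun s hs => ?_
    have hs2 : s + 2 ≤ 2 * N := by have := Finset.mem_range.1 hs; omega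
    have hv : ((s : ℕ) : ZMod M).val = s := by rw [ZMod.val_natCast, Nat.mod_eq_of_lt (by omega)]
    simp only [hv, if_pos hs2, smul_eq_mul]
    ring
  · intro s hsM hs
    have hs' : ¬ (s + 2 ≤ 2 * N) := fun h => hs (Finset.mem_range.2 (by omega))
    have hv : ((s : ℕ) : ZMod M).val = s := by
      rw [ZMod.val_natCast, Nat.mod_eq_of_lt (Finset.mem_range.1 hsM)]
    simp only [hv, if_neg hs', smul_zero]

/-- **Twisted sums with an arbitrary offset are mixed character sums** (`p` odd): a uniform bound `B` for
`|Σ_{N'<n≤N'+H} e(θn)χ_p(n)|` bounds `|Σ_{s<H} χ_p(c₀+s) e(−sk/M)|` for every `c₀ ∈ ℤ`. [folklore] -/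
theorem norm_twistedSum_offset_le_of_mixedBound (hp2 : p ≠ 2) (c₀ : ℤ) (H : ℕ) (M : ℕ) [NeZero M]
    (k : ZMod M) (B : ℝ)
    (hmix : ∀ (θ : ℝ) (N' : ℤ), ‖∑ n ∈ Finset.Ioc N' (N' + H), Complex.exp (2 * π * I * θ * n) *
        (quadraticChar (ZMod p)).ringHomComp (Int.castRingHom ℂ) (n : ZMod p)‖ ≤ B) :
    ‖∑ s ∈ Finset.range H, ((legendreSym p (c₀ + (s : ℤ)) : ℤ) : ℂ) *
        (ZMod.stdAddChar (-((s : ZMod M) * k)) : ℂ)‖ ≤ B := by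
  -- `2x ≡ c₀ (mod p)` with `x = c₀ (p+1)/2`
  have hodd : p % 2 = 1 := Nat.odd_iff.1 ((Fact.out : p.Prime).odd_of_ne_two hp2)
  set x : ℤ := c₀ * (((p + 1) / 2 : ℕ) : ℤ) with hx
  have hcast : ∀ s : ℕ, ((2 * x + (s : ℤ) * 1 : ℤ) : ZMod p) = ((c₀ + (s : ℤ) : ℤ) : ZMod p) := by
    intro s
    have h2 : (2 * x : ℤ) = c₀ * (p : ℤ) + c₀ := by
      rw [hx]
      have : (((p + 1) / 2 : ℕ) : ℤ) * 2 = (p : ℤ) + 1 := by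
        have h : (p + 1) / 2 * 2 = p + 1 := Nat.div_mul_cancel (by omega)
        exact_mod_cast h
      linear_combination c₀ * this
    rw [mul_one, h2]
    push_cast
    rw [ZMod.natCast_self]; ring
  have hterm : ∀ s : ℕ, ((legendreSym p (c₀ + (s : ℤ)) : ℤ) : ℂ) =
      ((legendreSym p (2 * x + (s : ℤ) * 1) : ℤ) : ℂ) := by
    intro s; rw [legendreSym_eq_of_cast_eq p (hcast s)]
  simp_rw [hterm]
  exact norm_twistedSum_le_of_mixedBound p x 1 (by rw [Int.cast_one]; exact one_ne_zero) H M k B hmix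

end Intervals

end

end Summit.ValiantsHypothesis.ValiantsHypothesis.Theorems.FeketeSOSHardPaleyRIP
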